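import Mathlib.NumberTheory.Height.NumberField
import Mathlib.NumberTheory.Height.MvPolynomial
import Mathlib.RingTheory.MvPolynomial.Homogeneous
import HarnessLib

/-!
# Roy's small value estimate for `𝔾ₐ × 𝔾ₘ` — Liouville's inequality for the value of an integer form at an algebraic point

Topic `Literature/NumberTheory/Transcendental`. Part of the formalisation of the proof of Roy 2013,
Theorem 1.1 (named fact `roy2013_thm_1_1`, `RoySmallValueEstimates.lean`), seat B (an
elimination-free reorganisation of §§2, 5–6 of D. Roy, *A small value estimate for `𝔾ₐ × 𝔾ₘ`*,
Mathematika 59 (2013) 333–363 = arXiv:1301.0663).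

Roy's Proposition 2.3 (second half, display (2.2), p. 5 of the arXiv text) is the Liouville-type
inequality `0 ≤ 7 log(m+1) D deg(Z) + D h(Z) + ∑_{α ∈ Z} log |P(α)|` for a zero-dimensional
`ℚ`-subvariety `Z` of `ℙ^m`, representatives `α` of norm `1` of its points and an integer form
`P ∈ ℤ[X]_D` outside the ideal of `Z`; there it is read off the Chow form of `Z`. In this
development the points of `Z` are the conjugates `σ(a)` (`σ : K →+* ℂ`) of a point `a ∈ K^{ι}` over
a number field `K`, `h` is the height RELATIVE to `K` (Mathlib's `Height.mulHeight`,
`Height.logHeight` for the admissible family of places of `K`), and the inequality is proved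
directly from the product formula:

* `finitePlace_aeval_le` — at a finite place `w`, `|P(a)|_w ≤ (max_i |a_i|_w)^D` (integer
  coefficients, ultrametric inequality);
* `one_le_mulHeight_pow_mul_prod` — **Liouville, multiplicative form**: if `P(a) ≠ 0` then
  `1 ≤ H_K(a)^D ∏_{σ : K →+* ℂ} |σ(P(a))| / ‖σ ∘ a‖^D` (`‖·‖` the sup norm on `ℂ^ι`), i.e. the
  product over all conjugates of the values of `P` at the unit representatives `σ(a)/‖σ(a)‖` is at
  least `H_K(a)^{-D}`;
* `neg_logHeight_le_sum_log` — **logarithmic form**: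
  `-D h_K(a) ≤ ∑_σ log (|σ(P(a))| / ‖σ ∘ a‖^D)`.

Everything here is proved; no definitions, no named facts.

## References

* [Roy2013] D. Roy, *A small value estimate for 𝔾ₐ × 𝔾ₘ*, Mathematika 59 (2013), 333–363
  (arXiv:1301.0663), §2, Prop. 2.3, (2.2); §7 Step 4 (its use).
-/

noncomputable section

open MvPolynomial NumberField Height Finset

namespace Literature.NumberTheory.Transcendental

namespace Roy2013

variable {K : Type*} [Field K] [NumberField K] {ι : Type*} [Fintype ι]

/-! ### Local estimates -/

/-- Rational integers have absolute value `≤ 1` at every finite place. [folklore] -/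
theorem finitePlace_intCast_le_one (w : FinitePlace K) (n : ℤ) : w (n : K) ≤ 1 := by
  have h : IsNonarchimedean w.val := FinitePlace.add_le w
  exact h.apply_intCast_le_one

/-- **Finite places**: for `P ∈ ℤ[X]` homogeneous of degree `D` and a finite place `w` of `K`,
`|P(a)|_w ≤ (max_i |a_i|_w)^D`. [cite: Roy2013, Prop. 2.3 (proof) — the ultrametric estimate
behind Liouville's inequality] -/
theorem finitePlace_aeval_le (w : FinitePlace K) {P : MvPolynomial ι ℤ} {D : ℕ}
    (hP : P.IsHomogeneous D) (a : ι → K) :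
    w (aeval a P) ≤ (⨆ i, w (a i)) ^ D := by
  have hPK : (map (Int.castRingHom K) P).IsHomogeneous D := hP.map _
  have heval : aeval a P = eval a (map (Int.castRingHom K) P) := by
    rw [eval_map, aeval_def]; rfl
  rw [heval, FinitePlace.coe_apply]
  refine (IsNonarchimedean.eval_mvPolynomial_le (FinitePlace.add_le w) hPK a).trans ?_
  have hsup : (⨆ s : (map (Int.castRingHom K) P).support,
      w.val (coeff (s : ι →₀ ℕ) (map (Int.castRingHom K) P))) ≤ 1 := by
    rcases isEmpty_or_nonempty (map (Int.castRingHom K) P).support with h | h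
    · rw [Real.iSup_of_isEmpty]; exact zero_le_one
    · refine ciSup_le fun s => ?_
      rw [coeff_map]
      exact finitePlace_intCast_le_one w _
  have h0 : 0 ≤ (⨆ i, w.val (a i)) ^ D := pow_nonneg (Real.iSup_nonneg fun i => apply_nonneg _ _) _
  calc _ ≤ 1 * (⨆ i, w.val (a i)) ^ D := mul_le_mul_of_nonneg_right hsup h0
    _ = _ := by rw [one_mul]; rfl

omit [NumberField K] in
/-- The sup norm of the image of a tuple under an embedding is the `max` of the place.
[folklore] -/
theorem norm_comp_embedding_eq_iSup (σ : K →+* ℂ) (a : ι → K) :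
    ‖(σ ∘ a : ι → ℂ)‖ = ⨆ i, (InfinitePlace.mk σ) (a i) := by
  rw [Pi.norm_def, Finset.sup_univ_eq_ciSup, NNReal.coe_iSup]
  rfl

/-- For `a ≠ 0`, `v ↦ max_i |a_i|_v` is `1` for almost all finite places `v`. [folklore] -/
theorem hasFiniteMulSupport_iSup_finitePlace' {x : ι → K} (hx : x ≠ 0) :
    (fun v : FinitePlace K => ⨆ i, v (x i)).HasFiniteMulSupport := by
  have hne : Nonempty {j // x j ≠ 0} := nonempty_subtype.mpr <| Function.ne_iff.mp hx
  suffices h : (fun v : FinitePlace K => ⨆ i : {j // x j ≠ 0}, v (x i)).HasFiniteMulSupport by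
    convert h using 2 with v
    obtain ⟨i, hi⟩ : ∃ j, x j ≠ 0 := Function.ne_iff.mp hx
    have : Nonempty ι := ⟨i⟩
    refine le_antisymm (ciSup_le fun j => ?_) (ciSup_le fun ⟨j, hj⟩ => Finite.le_ciSup_of_le j le_rfl)
    rcases eq_or_ne (x j) 0 with h | h
    · rw [h, map_zero]
      exact Real.iSup_nonneg' ⟨⟨i, hi⟩, apply_nonneg v _⟩
    · exact Finite.le_ciSup_of_le ⟨j, h⟩ le_rfl
  exact Function.HasFiniteMulSupport.iSup fun j => FinitePlace.hasFiniteMulSupport j.2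

/-! ### Liouville's inequality -/

/-- **Liouville's inequality, multiplicative form.** Let `K` be a number field, `a ∈ K^ι ∖ {0}`,
and `P ∈ ℤ[X]` homogeneous of degree `D` with `P(a) ≠ 0`. Then
`1 ≤ H_K(a)^D · ∏_{σ : K →+* ℂ} |σ(P(a))| / ‖σ ∘ a‖^D`, where `H_K = Height.mulHeight` is the
multiplicative height relative to `K` and `‖σ ∘ a‖` the sup norm; the factor
`|σ(P(a))| / ‖σ∘a‖^D` is the modulus of the value of `P` at the unit representative of the
conjugate point `σ(a)`. This is Roy's (2.2) for the orbit of `a`, with `D h(Z)` realised as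
`D h_K(a)` and without the slack `7 log(m+1) D deg Z`. [cite: Roy2013, Prop. 2.3, (2.2)] -/
theorem one_le_mulHeight_pow_mul_prod {P : MvPolynomial ι ℤ} {D : ℕ} (hP : P.IsHomogeneous D)
    {a : ι → K} (ha0 : a ≠ 0) (ha : aeval a P ≠ 0) :
    1 ≤ mulHeight a ^ D * ∏ σ : K →+* ℂ, ‖σ (aeval a P)‖ / ‖(σ ∘ a : ι → ℂ)‖ ^ D := by
  classical
  set x : K := aeval a P with hxdef
  -- local quantities at the infinite places
  set N : InfinitePlace K → ℝ := fun v => ⨆ i, v (a i) with hN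
  have hNpos : ∀ v : InfinitePlace K, 0 < N v := by
    intro v
    obtain ⟨i, hi⟩ := Function.ne_iff.mp ha0
    exact lt_of_lt_of_le (v.pos_iff.mpr hi) (Finite.le_ciSup (fun j => v (a j)) i)
  have hnormσ : ∀ σ : K →+* ℂ, ‖(σ ∘ a : ι → ℂ)‖ = N (InfinitePlace.mk σ) := fun σ =>
    norm_comp_embedding_eq_iSup σ a
  have hnormpos : ∀ σ : K →+* ℂ, 0 < ‖(σ ∘ a : ι → ℂ)‖ := fun σ => by
    rw [hnormσ]; exact hNpos _
  -- the product formula for `x`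
  have hpf := prod_abs_eq_one ha
  -- finite places: `∏ᶠ |x|_w ≤ (∏ᶠ max|a_i|_w)^D`
  have hfin : ∏ᶠ w : FinitePlace K, w x ≤ (∏ᶠ w : FinitePlace K, ⨆ i, w (a i)) ^ D := by
    rw [finprod_pow (hasFiniteMulSupport_iSup_finitePlace' ha0)]
    exact finprod_le_finprod (FinitePlace.hasFiniteMulSupport ha) (fun w => apply_nonneg _ _)
      ((hasFiniteMulSupport_iSup_finitePlace' ha0).pow D) fun w => finitePlace_aeval_le w hP a
  -- infinite places: `∏_v |x|_v^{mult} = ∏_σ |σ x|`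
  have hinf : ∏ v : InfinitePlace K, v x ^ v.mult = ∏ σ : K →+* ℂ, ‖σ x‖ := by
    rw [← Finset.prod_fiberwise univ (fun σ : K →+* ℂ => InfinitePlace.mk σ)]
    refine prod_congr rfl fun v _ => ?_
    rw [← InfinitePlace.card_filter_mk_eq v, ← prod_const]
    refine prod_congr rfl fun σ hσ => ?_
    rw [mem_filter] at hσ
    rw [← hσ.2, InfinitePlace.apply]
  have hinfN : ∏ v : InfinitePlace K, N v ^ v.mult = ∏ σ : K →+* ℂ, ‖(σ ∘ a : ι → ℂ)‖ := by
    rw [← Finset.prod_fiberwise univ (fun σ : K →+* ℂ => InfinitePlace.mk σ)]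
    refine prod_congr rfl fun v _ => ?_
    rw [← InfinitePlace.card_filter_mk_eq v, ← prod_const]
    refine prod_congr rfl fun σ hσ => ?_
    rw [mem_filter] at hσ
    rw [hnormσ, hσ.2]
  -- split `|σ x| = (|σ x| / ‖σ a‖^D) · ‖σ a‖^D`
  have hsplit : ∏ σ : K →+* ℂ, ‖σ x‖ =
      (∏ σ : K →+* ℂ, ‖σ x‖ / ‖(σ ∘ a : ι → ℂ)‖ ^ D) * (∏ σ : K →+* ℂ, ‖(σ ∘ a : ι → ℂ)‖) ^ D := by
    rw [← prod_pow, ← prod_mul_distrib]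
    refine prod_congr rfl fun σ _ => ?_
    rw [div_mul_cancel₀ _ (pow_ne_zero _ (hnormpos σ).ne')]
  -- assemble
  have hH : mulHeight a = (∏ v : InfinitePlace K, N v ^ v.mult) *
      ∏ᶠ w : FinitePlace K, ⨆ i, w (a i) := NumberField.mulHeight_eq ha0
  have hratio_nn : 0 ≤ ∏ σ : K →+* ℂ, ‖σ x‖ / ‖(σ ∘ a : ι → ℂ)‖ ^ D :=
    prod_nonneg fun σ _ => div_nonneg (norm_nonneg _) (pow_nonneg (norm_nonneg _) _)
  have hinf_nn : 0 ≤ (∏ σ : K →+* ℂ, ‖(σ ∘ a : ι → ℂ)‖) ^ D :=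
    pow_nonneg (prod_nonneg fun σ _ => norm_nonneg _) _
  calc (1 : ℝ) = (∏ v : InfinitePlace K, v x ^ v.mult) * ∏ᶠ w : FinitePlace K, w x := hpf.symm
    _ ≤ (∏ v : InfinitePlace K, v x ^ v.mult) * (∏ᶠ w : FinitePlace K, ⨆ i, w (a i)) ^ D :=
        mul_le_mul_of_nonneg_left hfin (prod_nonneg fun v _ => pow_nonneg (apply_nonneg _ _) _)
    _ = (∏ σ : K →+* ℂ, ‖σ x‖ / ‖(σ ∘ a : ι → ℂ)‖ ^ D) *
          ((∏ v : InfinitePlace K, N v ^ v.mult) * ∏ᶠ w : FinitePlace K, ⨆ i, w (a i)) ^ D := by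
        rw [hinf, hsplit, hinfN, mul_pow]; ring
    _ = mulHeight a ^ D * ∏ σ : K →+* ℂ, ‖σ (aeval a P)‖ / ‖(σ ∘ a : ι → ℂ)‖ ^ D := by
        rw [← hH, mul_comm]

/-- **Liouville's inequality, logarithmic form**: for `a ≠ 0` and `P ∈ ℤ[X]_D` with `P(a) ≠ 0`,
`-D · h_K(a) ≤ ∑_{σ : K →+* ℂ} log (|σ(P(a))| / ‖σ ∘ a‖^D)` (`h_K = Height.logHeight`, the
logarithmic height relative to `K`, i.e. `[K:ℚ]` times the absolute logarithmic Weil height).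
[cite: Roy2013, Prop. 2.3, (2.2)] -/
theorem neg_logHeight_le_sum_log {P : MvPolynomial ι ℤ} {D : ℕ} (hP : P.IsHomogeneous D)
    {a : ι → K} (ha0 : a ≠ 0) (ha : aeval a P ≠ 0) :
    -(D * logHeight a) ≤ ∑ σ : K →+* ℂ, Real.log (‖σ (aeval a P)‖ / ‖(σ ∘ a : ι → ℂ)‖ ^ D) := by
  have h := one_le_mulHeight_pow_mul_prod hP ha0 ha
  have hpos : ∀ σ : K →+* ℂ, 0 < ‖σ (aeval a P)‖ / ‖(σ ∘ a : ι → ℂ)‖ ^ D := by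
    intro σ
    refine div_pos (norm_pos_iff.mpr ?_) (pow_pos (norm_pos_iff.mpr ?_) _)
    · exact (map_ne_zero σ).mpr ha
    · intro h0
      apply ha0
      funext i
      have := congr_fun h0 i
      simpa using this
  have hprod : 0 < ∏ σ : K →+* ℂ, ‖σ (aeval a P)‖ / ‖(σ ∘ a : ι → ℂ)‖ ^ D :=
    prod_pos fun σ _ => hpos σ
  have hlog := Real.log_le_log one_pos h
  rw [Real.log_one, Real.log_mul (pow_ne_zero _ (mulHeight_pos a).ne') hprod.ne', Real.log_pow,
    Real.log_prod (fun σ _ => (hpos σ).ne')] at hlog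
  rw [logHeight_eq_log_mulHeight]
  linarith

end Roy2013

end Literature.NumberTheory.Transcendental
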